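import Summits.AtomisticToContinuum.Crystallization.Theorems.FreeSplittingCertificatesStrictSplittingRuleCoreFirstOrderDesignTruss
import Summits.AtomisticToContinuum.Crystallization.Theorems.FreeSplittingCertificatesStrictSplittingRuleCoreDefs
import Summits.AtomisticToContinuum.Crystallization.Theorems.FreeSplittingCertificatesStrictSplittingRuleCoreHall

/-!
# `StrictSplittingRule` (stmt-AtomisticToContinuum-12560), line `birth`: stub `stub_coreFirstOrderDesign` (H1)

PROVED: `CoreFirstOrderDesign a h` at every hcp-family minimiser — an EXPLICIT Bravais-covariant, finitely
stencilled, `(1+r)⁻⁶`-decaying antisymmetrised linear bond transfer cancelling the naive half-split first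
variation of the site energy at every site of relaxed `hcp(a, h)`, for every finitely supported displacement.
Design (files `…CoreFirstOrderDesignGeometry`, `…Truss`): stencil `Y = {(0,1,0), (0,0,1), (0,−1,1), (2,0,0)}`
(site vectors `u, v, v − u, 2h e₃`, all Bravais), frame weights `λ = 2/(3a²)` (in-layer), `1/(4h²)` (vertical),
and `β(b, d, s) = λ_s · τ (parity of the receiver) s (−d)`, the tension of the sender's own `s`-bond in the LINE
TRUSS of the receiver.  The identity at a site `p` (`h1_identity`): zero force drops `u_p` from the first
variation (`h1_V_force`); the transfers `p` sends are `dl u p s` times the total tension all other sites put on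
their `s`-bond when THEY receive from `p` — by covariance the total over all sites of one tension field, which
VANISHES (`h1_total_tension`: summation by parts against the affine coordinate along `s` gives the stress form
`‖y_s‖⁻² Σ_d W′(‖y_d‖²)⟪y_d, y_s⟫²`, zero by `core_zeroStress` — the only use of minimality); so the sent
transfers are minus `p`'s own bond terms and complete the received ones to the full bond sum
`−Σ_d Σ_s λ_s τ_s(d) dl u (p+d) s` = minus the first variation (node equilibrium + frame identity, `h1_divergence`).
Decay: `h1_tau_bound`.  Sources: FrieseckeTheil2002, HudsonOrtner2011, BlancLewin2015 §2; all `[folklore]`.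
-/
noncomputable section

namespace Summit.AtomisticToContinuum.Crystallization.Theorems.StrictSplittingRuleBirth

open scoped BigOperators
open Literature.MathematicalPhysics.StatisticalMechanics
open Summit.AtomisticToContinuum.Crystallization.Theorems.PalmUnimodularRigidity.LayeredLawsSelectHcp

/-! ## §1 Root force and stress form from either sublattice; the total tension -/

section Totals

variable {a h : ℝ} {V : Bool → ℤ × ℤ × ℤ → EuclideanSpace ℝ (Fin 3)} {F : Bool → (ℤ × ℤ × ℤ) → (ℤ × ℤ × ℤ) → ℤ → ℝ}
  {τ : Bool → (ℤ × ℤ × ℤ) → (ℤ × ℤ × ℤ) → ℝ} {Y : Finset (ℤ × ℤ × ℤ)}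

/-- Zero force on a site of either parity: `Σ_d W′(‖V b d‖²)⟪V b d, x⟫ = 0`, with summability. [folklore] -/
theorem h1_V_force (ha : 0 < a) (hh : 0 < h)
    (hV : ∀ c d, V c d = if c = true then hcpSite a h d else -hcpSite a h (-d)) (b : Bool) (x : EuclideanSpace ℝ (Fin 3)) :
    (Summable fun d : ℤ × ℤ × ℤ => ljSqDeriv (‖V b d‖ ^ 2) * inner ℝ (V b d) x) ∧
      ∑' d : ℤ × ℤ × ℤ, ljSqDeriv (‖V b d‖ ^ 2) * inner ℝ (V b d) x = 0 := by
  obtain ⟨hs, h0⟩ := h1_force_zero ha.ne' hh.ne' x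
  cases b
  · simp_rw [h1_V_false hV, norm_neg, inner_neg_left, mul_neg]
    refine ⟨(hs.comp_injective neg_injective).neg, ?_⟩
    rw [tsum_neg, neg_eq_zero]
    exact ((Equiv.neg (ℤ × ℤ × ℤ)).tsum_eq fun d => ljSqDeriv (‖hcpSite a h d‖ ^ 2) *
      inner ℝ (hcpSite a h d) x).trans h0
  · simp_rw [h1_V_true hV]
    exact ⟨hs, h0⟩

/-- Zero stress form on a site of either parity: `Σ_d W′(‖V b d‖²)⟪V b d, x⟫² = 0`, with summability. [folklore] -/
theorem h1_V_stress (ha : 0 < a) (hh : 0 < h)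
    (hV : ∀ c d, V c d = if c = true then hcpSite a h d else -hcpSite a h (-d))
    (hS : ∀ l m : Fin 3, hcpSiteStress a h l m = 0) (b : Bool) (x : EuclideanSpace ℝ (Fin 3)) :
    (Summable fun d : ℤ × ℤ × ℤ => ljSqDeriv (‖V b d‖ ^ 2) * inner ℝ (V b d) x ^ 2) ∧
      ∑' d : ℤ × ℤ × ℤ, ljSqDeriv (‖V b d‖ ^ 2) * inner ℝ (V b d) x ^ 2 = 0 := by
  obtain ⟨hs, h0⟩ := h1_stressForm ha.ne' hh.ne' x
  simp only [hS, mul_zero, Finset.sum_const_zero] at h0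
  cases b
  · simp_rw [h1_V_false hV, norm_neg, inner_neg_left, neg_sq]
    exact ⟨hs.comp_injective neg_injective, ((Equiv.neg (ℤ × ℤ × ℤ)).tsum_eq fun d =>
      ljSqDeriv (‖hcpSite a h d‖ ^ 2) * inner ℝ (hcpSite a h d) x ^ 2).trans h0⟩
  · simp_rw [h1_V_true hV]
    exact ⟨hs, h0⟩

/-- **The total tension vanishes** (the only use of zero stress).  The tensions `B(d) = τ (parity of p+d) s (−d)`
that ALL sites `p + d` put on their own `s`-bond in the problem of the receiver `p` (parity `b`) are summable with
`Σ_d B(d) = 0`: `B(d + s) − B(d) = −W′⟪V b d, y_s⟫` (recursion + flip), and summation by parts against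
`π(d) = ⟪V b d, y_s⟫/‖y_s‖²` (`π(d + s) = π(d) + 1`) gives `‖y_s‖⁻² Σ_d W′(‖V b d‖²)⟪V b d, y_s⟫² = 0`. [folklore] -/
theorem h1_total_tension (ha : 0 < a) (hh : 0 < h)
    (hV : ∀ c d, V c d = if c = true then hcpSite a h d else -hcpSite a h (-d))
    (hF : ∀ c s d n, F c s d n =
      ljSqDeriv (‖V c (d + n • s)‖ ^ 2) * inner ℝ (V c (d + n • s)) (hcpSite a h s))
    (hτ : ∀ c s d, τ c s d = if 0 ≤ inner ℝ (V c d) (hcpSite a h s) then ∑' m : ℕ, F c s d ((m : ℤ) + 1)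
      else -(F c s d 0 + ∑' m : ℕ, F c s d (-((m : ℤ) + 1))))
    (hS : ∀ l m : Fin 3, hcpSiteStress a h l m = 0) (hY : Y = ({(0, 1, 0), (0, 0, 1), (0, -1, 1), (2, 0, 0)} : Finset (ℤ × ℤ × ℤ)))
    (b : Bool) {s : ℤ × ℤ × ℤ} (hs : s ∈ Y) :
    (Summable fun d : ℤ × ℤ × ℤ => τ (if Even d.1 then b else !b) s (-d)) ∧
      ∑' d : ℤ × ℤ × ℤ, τ (if Even d.1 then b else !b) s (-d) = 0 := by
  set e := hcpSite a h s with he_def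
  have hs' : s ∈ ({(0, 1, 0), (0, 0, 1), (0, -1, 1), (2, 0, 0)} : Finset (ℤ × ℤ × ℤ)) := hY ▸ hs
  have hse := h1_stencil_even hs'
  have hs0 : s ≠ 0 := by rintro rfl; exact absurd hs' (by decide)
  have hepos : 0 < ‖e‖ := (lt_min ha hh).trans_le (h1_norm_ge ha hh hs0)
  set K : ℝ := 1 / 2 * (1 + (((min a h) ^ 2)⁻¹) ^ 3) *
    ((8 / 3 + (a + 2 * h) * (min a h)⁻¹) * (1 + (min a h)⁻¹) ^ 6 + 11 / 3 * ((min a h)⁻¹) ^ 6) with hK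
  set B : ℤ × ℤ × ℤ → ℝ := fun d => τ (if Even d.1 then b else !b) s (-d) with hB
  set π : ℤ × ℤ × ℤ → ℝ := fun d => inner ℝ (V b d) e / ‖e‖ ^ 2 with hπ
  set G : ℤ × ℤ × ℤ → ℝ := fun d => ljSqDeriv (‖V b d‖ ^ 2) * inner ℝ (V b d) e with hG
  -- pointwise facts
  have hbd : ∀ d, |B d| ≤ K * ((1 + ‖V b d‖)⁻¹) ^ 6 := fun d => by
    have := h1_tau_bound ha hh hV hF hτ (if Even d.1 then b else !b) hs' (-d)
    rwa [h1_V_flip hV, norm_neg] at this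
  have hπs : ∀ d, π (d + s) = π d + 1 := fun d => by
    simp only [hπ]
    rw [show d + s = d + (1 : ℤ) • s by rw [one_smul], h1_V_line hV b hse, inner_add_left, real_inner_smul_left,
      real_inner_self_eq_norm_sq]
    field_simp
    push_cast
    ring
  have hrec : ∀ d, B (d + s) = B d - G d := by
    intro d
    have hpar : (if Even (d + s).1 then b else !b) = (if Even d.1 then b else !b) := by
      have : Even (d + s).1 ↔ Even d.1 := by
        show Even (d.1 + s.1) ↔ Even d.1
        exact ⟨fun h' => by simpa using h'.sub hse, fun h' => h'.add hse⟩
      simp only [this]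
    have key := h1_tau_rec ha hh hV hF hτ (if Even d.1 then b else !b) hs' (-d)
    rw [hF, zero_smul, add_zero, h1_V_flip hV, norm_neg, inner_neg_left] at key
    simp only [hB, hpar, neg_add, hG]
    rw [show -d + -s = -d - s from (sub_eq_add_neg _ _).symm]
    linarith
  -- summability
  have hKs := (h1_V_summable ha hh hV b (by norm_num : 3 < 6)).mul_left K
  have hsB : Summable B := Summable.of_norm_bounded hKs fun d => by rw [Real.norm_eq_abs]; exact hbd d
  have hsBπ : Summable fun d => B d * π d := by
    refine Summable.of_norm_bounded ((h1_V_summable ha hh hV b (by norm_num : 3 < 5)).mul_left (K * ‖e‖⁻¹))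
      fun d => ?_
    rw [Real.norm_eq_abs, abs_mul]
    have hπb : |π d| ≤ ‖e‖⁻¹ * ‖V b d‖ := by
      simp only [hπ]
      rw [abs_div, abs_of_pos (by positivity : (0 : ℝ) < ‖e‖ ^ 2), div_le_iff₀ (by positivity)]
      calc |inner ℝ (V b d) e| ≤ ‖V b d‖ * ‖e‖ := abs_real_inner_le_norm _ _
        _ = ‖e‖⁻¹ * ‖V b d‖ * ‖e‖ ^ 2 := by field_simp
    have h1 : ‖V b d‖ * ((1 + ‖V b d‖)⁻¹) ^ 6 ≤ ((1 + ‖V b d‖)⁻¹) ^ 5 := by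
      rw [show ((1 + ‖V b d‖)⁻¹) ^ 6 = ((1 + ‖V b d‖)⁻¹) ^ 5 * (1 + ‖V b d‖)⁻¹ by ring, ← mul_assoc,
        mul_comm (‖V b d‖), mul_assoc]
      refine mul_le_of_le_one_right (by positivity) ?_
      rw [mul_inv_le_iff₀ (by positivity), one_mul]
      linarith
    calc |B d| * |π d| ≤ (K * ((1 + ‖V b d‖)⁻¹) ^ 6) * (‖e‖⁻¹ * ‖V b d‖) :=
          mul_le_mul (hbd d) hπb (abs_nonneg _) (by positivity)
      _ = K * ‖e‖⁻¹ * (‖V b d‖ * ((1 + ‖V b d‖)⁻¹) ^ 6) := by ring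
      _ ≤ K * ‖e‖⁻¹ * ((1 + ‖V b d‖)⁻¹) ^ 5 := by gcongr
  have hsBπ' : Summable fun d => B d * π (d - s) :=
    (hsBπ.sub hsB).congr fun d => by rw [show π (d - s) = π d - 1 by have := hπs (d - s); rw [sub_add_cancel] at this; linarith]; ring
  have hsBπ'' : Summable fun d => B (d + s) * π d :=
    ((hsBπ'.comp_injective (add_left_injective s))).congr fun d => by simp
  obtain ⟨hsG2, hG0⟩ := h1_V_stress ha hh hV hS b e
  -- summation by parts
  refine ⟨hsB, ?_⟩
  calc ∑' d, B d = ∑' d, (B d * π d - B d * π (d - s)) := tsum_congr fun d => by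
          rw [show π (d - s) = π d - 1 by have := hπs (d - s); rw [sub_add_cancel] at this; linarith]; ring
    _ = ∑' d, B d * π d - ∑' d, B d * π (d - s) := hsBπ.tsum_sub hsBπ'
    _ = ∑' d, B d * π d - ∑' d, B (d + s) * π d := by
        rw [← (Equiv.addRight s).tsum_eq fun d => B d * π (d - s)]
        simp
    _ = ∑' d, (B d * π d - B (d + s) * π d) := (hsBπ.tsum_sub hsBπ'').symm
    _ = ∑' d, (‖e‖ ^ 2)⁻¹ * (ljSqDeriv (‖V b d‖ ^ 2) * inner ℝ (V b d) e ^ 2) := tsum_congr fun d => by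
        rw [hrec]; simp only [hπ, hG]; field_simp; ring
    _ = 0 := by rw [tsum_mul_left, hG0, mul_zero]

end Totals

/-! ## §2 The discrete divergence identity and the first-order identity at a site -/

section Assembly

variable {a h : ℝ} {V : Bool → ℤ × ℤ × ℤ → EuclideanSpace ℝ (Fin 3)} {F : Bool → (ℤ × ℤ × ℤ) → (ℤ × ℤ × ℤ) → ℤ → ℝ}
  {τ : Bool → (ℤ × ℤ × ℤ) → (ℤ × ℤ × ℤ) → ℝ} {lam : ℤ × ℤ × ℤ → ℝ} {u : ℤ × ℤ × ℤ → EuclideanSpace ℝ (Fin 3)}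
  {Y : Finset (ℤ × ℤ × ℤ)}

/-- **Discrete divergence identity** (tested against a finitely supported field): summing the stencil-bond
readouts `λ_s τ b s d ⟪y_s, u_{p+d+s} − u_{p+d}⟫` over all bonds and regrouping by node gives, by the tension
recursion and the frame identity, the radial loads tested against `u`:
`Σ_d Σ_s λ_s τ b s d ⟪y_s, u_{p+d+s} − u_{p+d}⟫ = Σ_d W′(‖V b d‖²)⟪V b d, u_{p+d}⟫`. [folklore] -/
theorem h1_divergence (ha : 0 < a) (hh : 0 < h)
    (hV : ∀ c d, V c d = if c = true then hcpSite a h d else -hcpSite a h (-d))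
    (hF : ∀ c s d n, F c s d n =
      ljSqDeriv (‖V c (d + n • s)‖ ^ 2) * inner ℝ (V c (d + n • s)) (hcpSite a h s))
    (hτ : ∀ c s d, τ c s d = if 0 ≤ inner ℝ (V c d) (hcpSite a h s) then ∑' m : ℕ, F c s d ((m : ℤ) + 1)
      else -(F c s d 0 + ∑' m : ℕ, F c s d (-((m : ℤ) + 1))))
    (hlam : ∀ s, lam s = if s.1 = 0 then 2 / (3 * a ^ 2) else 1 / (4 * h ^ 2)) (hY : Y = ({(0, 1, 0), (0, 0, 1), (0, -1, 1), (2, 0, 0)} : Finset (ℤ × ℤ × ℤ)))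
    (b : Bool) (hu : (Function.support u).Finite) (p : ℤ × ℤ × ℤ) :
    ∑' d : ℤ × ℤ × ℤ, ∑ s ∈ Y, lam s * τ b s d * inner ℝ (hcpSite a h s) (u (p + d + s) - u (p + d)) =
      ∑' d : ℤ × ℤ × ℤ, ljSqDeriv (‖V b d‖ ^ 2) * inner ℝ (V b d) (u (p + d)) := by
  have hfin := h1_summable_of_support hu
  have hA : ∀ s ∈ Y, Summable fun d => τ b s d * inner ℝ (hcpSite a h s) (u (p + d + s)) := fun s _ =>
    (hfin (p + s) (fun d w => τ b s d * inner ℝ (hcpSite a h s) w) fun d => by simp).congr fun d => by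
      simp only [add_right_comm p s d]
  have hB : ∀ s ∈ Y, Summable fun d => τ b s d * inner ℝ (hcpSite a h s) (u (p + d)) := fun s _ =>
    hfin p (fun d w => τ b s d * inner ℝ (hcpSite a h s) w) fun d => by simp
  have hC : ∀ s ∈ Y, Summable fun d => τ b s (d - s) * inner ℝ (hcpSite a h s) (u (p + d)) := fun s _ =>
    hfin p (fun d w => τ b s (d - s) * inner ℝ (hcpSite a h s) w) fun d => by simp
  have hD : ∀ s ∈ Y, Summable fun d => lam s *
      (ljSqDeriv (‖V b d‖ ^ 2) * inner ℝ (V b d) (hcpSite a h s) * inner ℝ (hcpSite a h s) (u (p + d))) :=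
    fun s _ => hfin p (fun d w => lam s *
      (ljSqDeriv (‖V b d‖ ^ 2) * inner ℝ (V b d) (hcpSite a h s) * inner ℝ (hcpSite a h s) w)) fun d => by simp
  have hAB : ∀ s ∈ Y, Summable fun d => lam s * τ b s d * inner ℝ (hcpSite a h s) (u (p + d + s) - u (p + d)) :=
    fun s hs => (((hA s hs).sub (hB s hs)).mul_left (lam s)).congr fun d => by rw [inner_sub_right]; ring
  -- per direction: shift the far readout back to the node and apply the recursion
  have key : ∀ s ∈ Y, ∑' d, lam s * τ b s d * inner ℝ (hcpSite a h s) (u (p + d + s) - u (p + d)) =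
      ∑' d, lam s * (ljSqDeriv (‖V b d‖ ^ 2) * inner ℝ (V b d) (hcpSite a h s) *
        inner ℝ (hcpSite a h s) (u (p + d))) := by
    intro s hs
    have e1 : ∑' d, lam s * τ b s d * inner ℝ (hcpSite a h s) (u (p + d + s) - u (p + d)) =
        lam s * (∑' d, τ b s d * inner ℝ (hcpSite a h s) (u (p + d + s)) -
          ∑' d, τ b s d * inner ℝ (hcpSite a h s) (u (p + d))) := by
      rw [← (hA s hs).tsum_sub (hB s hs), ← tsum_mul_left]
      exact tsum_congr fun d => by rw [inner_sub_right]; ring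
    have e2 : ∑' d, τ b s d * inner ℝ (hcpSite a h s) (u (p + d + s)) =
        ∑' d, τ b s (d - s) * inner ℝ (hcpSite a h s) (u (p + d)) := by
      rw [← (Equiv.subRight s).tsum_eq fun d => τ b s d * inner ℝ (hcpSite a h s) (u (p + d + s))]
      exact tsum_congr fun d => by simp [sub_add_cancel, add_sub_assoc']
    have e3 : ∑' d, τ b s (d - s) * inner ℝ (hcpSite a h s) (u (p + d)) -
        ∑' d, τ b s d * inner ℝ (hcpSite a h s) (u (p + d)) =
        ∑' d, ljSqDeriv (‖V b d‖ ^ 2) * inner ℝ (V b d) (hcpSite a h s) * inner ℝ (hcpSite a h s) (u (p + d)) := by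
      rw [← (hC s hs).tsum_sub (hB s hs)]
      refine tsum_congr fun d => ?_
      have hrec := h1_tau_rec ha hh hV hF hτ b (hY ▸ hs) d
      rw [hF, zero_smul, add_zero] at hrec
      rw [← sub_mul, hrec]
    rw [e1, e2, e3, ← tsum_mul_left]
  rw [Summable.tsum_finsetSum hAB, Finset.sum_congr rfl key, ← Summable.tsum_finsetSum hD]
  refine tsum_congr fun d => ?_
  have hfr := h1_frame ha.ne' hh.ne' (V b d)
  calc ∑ s ∈ Y, lam s * (ljSqDeriv (‖V b d‖ ^ 2) * inner ℝ (V b d) (hcpSite a h s) *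
        inner ℝ (hcpSite a h s) (u (p + d)))
      = ljSqDeriv (‖V b d‖ ^ 2) * inner ℝ (∑ s ∈ Y,
          ((if s.1 = 0 then 2 / (3 * a ^ 2) else 1 / (4 * h ^ 2)) * inner ℝ (V b d) (hcpSite a h s)) •
            hcpSite a h s) (u (p + d)) := by
        rw [sum_inner, Finset.mul_sum]
        exact Finset.sum_congr rfl fun s _ => by rw [real_inner_smul_left, hlam]; ring
    _ = ljSqDeriv (‖V b d‖ ^ 2) * inner ℝ (V b d) (u (p + d)) := by rw [hY, hfr]

/-- **The first-order identity at a site** `p` (parity `b`) for `β b d s = λ_s · τ (parity of the receiver) s (−d)`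
and a finitely supported `u`: the first variation is `Σ_d W′(‖V b d‖²)⟪V b d, u_{p+d}⟫` (`h1_V_force`); the sent
transfers sum to `−Σ_s λ_s τ b s 0 · dl u p s` (`h1_total_tension`) and complete the received ones to
`−Σ_d Σ_s λ_s τ b s d · dl u (p+d) s`, minus the first variation (`h1_divergence`). [folklore] -/
theorem h1_identity (ha : 0 < a) (hh : 0 < h)
    (hV : ∀ c d, V c d = if c = true then hcpSite a h d else -hcpSite a h (-d))
    (hF : ∀ c s d n, F c s d n =
      ljSqDeriv (‖V c (d + n • s)‖ ^ 2) * inner ℝ (V c (d + n • s)) (hcpSite a h s))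
    (hτ : ∀ c s d, τ c s d = if 0 ≤ inner ℝ (V c d) (hcpSite a h s) then ∑' m : ℕ, F c s d ((m : ℤ) + 1)
      else -(F c s d 0 + ∑' m : ℕ, F c s d (-((m : ℤ) + 1))))
    (hS : ∀ l m : Fin 3, hcpSiteStress a h l m = 0)
    (hlam : ∀ s, lam s = if s.1 = 0 then 2 / (3 * a ^ 2) else 1 / (4 * h ^ 2)) (hY : Y = ({(0, 1, 0), (0, 0, 1), (0, -1, 1), (2, 0, 0)} : Finset (ℤ × ℤ × ℤ)))
    {β : Bool → (ℤ × ℤ × ℤ) → (ℤ × ℤ × ℤ) → ℝ}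
    (hβ : ∀ b d s, s ∈ Y → β b d s = lam s * τ (if Even d.1 then b else !b) s (-d))
    (hu : (Function.support u).Finite) (p : ℤ × ℤ × ℤ) :
    (∑' q : ℤ × ℤ × ℤ, (if q = p then (0 : ℝ) else
        ljSqDeriv (‖hcpSite a h q - hcpSite a h p‖ ^ 2) *
          inner ℝ (hcpSite a h q - hcpSite a h p) (u q - u p))) +
    (∑' q : ℤ × ℤ × ℤ, (if q = p then (0 : ℝ) else
        ∑ s ∈ Y, (β (decide (Even p.1)) (q - p) s *
            inner ℝ (hcpSite a h (p + s) - hcpSite a h p) (u (p + s) - u p) -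
          β (decide (Even q.1)) (p - q) s *
            inner ℝ (hcpSite a h (q + s) - hcpSite a h q) (u (q + s) - u q)))) = 0 := by
  set b := decide (Even p.1) with hb
  have hfin := h1_summable_of_support hu
  -- covariance, stencil bonds, parities
  have hcov : ∀ q, hcpSite a h q - hcpSite a h p = V b (q - p) := fun q => by
    have := h1_sub_eq a h p (q - p)
    rw [add_sub_cancel] at this
    rw [this, hV]
    simp [hb]
  have hst : ∀ z, ∀ s ∈ Y, hcpSite a h (z + s) - hcpSite a h z = hcpSite a h s := fun z s hs => by
    rw [h1_sub_eq]
    split_ifs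
    · rfl
    · rw [h1_neg_of_even a h (h1_stencil_even (hY ▸ hs)), neg_neg]
  have hpar1 : ∀ q : ℤ × ℤ × ℤ, (if Even (q - p).1 then b else !b) = decide (Even q.1) := fun q => by
    show (if Even (q.1 - p.1) then b else !b) = _
    by_cases hp : Even p.1 <;> by_cases hq : Even q.1 <;> simp [hb, hp, hq, Int.even_sub]
  have hpar2 : ∀ q : ℤ × ℤ × ℤ, (if Even (p - q).1 then decide (Even q.1) else !decide (Even q.1)) = b := fun q => by
    show (if Even (p.1 - q.1) then _ else _) = _
    by_cases hp : Even p.1 <;> by_cases hq : Even q.1 <;> simp [hb, hp, hq, Int.even_sub]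
  -- the two summands, without the case distinction at `q = p`
  have hS1 : ∀ q, (if q = p then (0 : ℝ) else ljSqDeriv (‖hcpSite a h q - hcpSite a h p‖ ^ 2) *
      inner ℝ (hcpSite a h q - hcpSite a h p) (u q - u p)) =
      ljSqDeriv (‖V b (q - p)‖ ^ 2) * inner ℝ (V b (q - p)) (u q) -
        ljSqDeriv (‖V b (q - p)‖ ^ 2) * inner ℝ (V b (q - p)) (u p) := fun q => by
    split_ifs with hq
    · rw [hq]; simp [h1_V_zero hV]
    · rw [hcov, inner_sub_right, mul_sub]
  have hS2 : ∀ q, (if q = p then (0 : ℝ) else ∑ s ∈ Y, (β b (q - p) s *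
      inner ℝ (hcpSite a h (p + s) - hcpSite a h p) (u (p + s) - u p) - β (decide (Even q.1)) (p - q) s *
        inner ℝ (hcpSite a h (q + s) - hcpSite a h q) (u (q + s) - u q))) =
      ∑ s ∈ Y, lam s * inner ℝ (hcpSite a h s) (u (p + s) - u p) * τ (decide (Even q.1)) s (p - q) -
        ∑ s ∈ Y, lam s * τ b s (q - p) * inner ℝ (hcpSite a h s) (u (q + s) - u q) := fun q => by
    rw [← Finset.sum_sub_distrib]
    split_ifs with hq
    · rw [hq, sub_self, ← hb]
      exact (Finset.sum_eq_zero fun s _ => by ring).symm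
    · refine Finset.sum_congr rfl fun s hs => ?_
      rw [hβ _ _ _ hs, hβ _ _ _ hs, hpar1, hpar2, neg_sub, neg_sub, hst p s hs, hst q s hs]
      ring
  rw [tsum_congr hS1, tsum_congr hS2]
  -- (1) the first variation: zero force drops `u_p`
  obtain ⟨hFs, hF0⟩ := h1_V_force ha hh hV b (u p)
  have h1a : Summable fun q => ljSqDeriv (‖V b (q - p)‖ ^ 2) * inner ℝ (V b (q - p)) (u q) :=
    (hfin p (fun d w => ljSqDeriv (‖V b d‖ ^ 2) * inner ℝ (V b d) w) fun d => by simp).comp_injective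
      (sub_left_injective (b := p)) |>.congr fun q => by simp
  have h1b : Summable fun q => ljSqDeriv (‖V b (q - p)‖ ^ 2) * inner ℝ (V b (q - p)) (u p) :=
    hFs.comp_injective sub_left_injective
  have h1c : ∑' q, ljSqDeriv (‖V b (q - p)‖ ^ 2) * inner ℝ (V b (q - p)) (u p) = 0 := by
    rw [← hF0]; exact (Equiv.subRight p).tsum_eq fun d => ljSqDeriv (‖V b d‖ ^ 2) * inner ℝ (V b d) (u p)
  have h1d : ∑' q, ljSqDeriv (‖V b (q - p)‖ ^ 2) * inner ℝ (V b (q - p)) (u q) =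
      ∑' d, ljSqDeriv (‖V b d‖ ^ 2) * inner ℝ (V b d) (u (p + d)) := by
    rw [← (Equiv.addLeft p).tsum_eq fun q => ljSqDeriv (‖V b (q - p)‖ ^ 2) * inner ℝ (V b (q - p)) (u q)]
    exact tsum_congr fun d => by simp
  -- (2) the receiver-side transfers: total tension zero
  have h2a : ∀ s ∈ Y, (Summable fun q => τ (decide (Even q.1)) s (p - q)) ∧
      ∑' q, τ (decide (Even q.1)) s (p - q) = 0 := by
    intro s hs
    obtain ⟨hsum, h0⟩ := h1_total_tension ha hh hV hF hτ hS hY b hs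
    have e : ∀ q, τ (if Even (q - p).1 then b else !b) s (-(q - p)) = τ (decide (Even q.1)) s (p - q) :=
      fun q => by rw [hpar1, neg_sub]
    refine ⟨(hsum.comp_injective sub_left_injective).congr e, ?_⟩
    rw [← h0, ← (Equiv.subRight p).tsum_eq fun d => τ (if Even d.1 then b else !b) s (-d)]
    exact tsum_congr fun q => (e q).symm
  have h2b : Summable fun q => ∑ s ∈ Y, lam s * inner ℝ (hcpSite a h s) (u (p + s) - u p) *
      τ (decide (Even q.1)) s (p - q) := summable_sum fun s hs => (h2a s hs).1.mul_left _
  have h2c : ∑' q, ∑ s ∈ Y, lam s * inner ℝ (hcpSite a h s) (u (p + s) - u p) *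
      τ (decide (Even q.1)) s (p - q) = 0 := by
    rw [Summable.tsum_finsetSum fun s hs => (h2a s hs).1.mul_left _]
    exact Finset.sum_eq_zero fun s hs => by rw [tsum_mul_left, (h2a s hs).2, mul_zero]
  -- (3) the sender-side transfers: a finitely supported bond sum, re-based at `p`
  have h3a : Summable fun q => ∑ s ∈ Y, lam s * τ b s (q - p) * inner ℝ (hcpSite a h s) (u (q + s) - u q) := by
    refine summable_sum fun s _ => ?_
    have hx : Summable fun q => lam s * τ b s (q - p) * inner ℝ (hcpSite a h s) (u (q + s)) :=
      ((hfin (p + s) (fun d w => lam s * τ b s d * inner ℝ (hcpSite a h s) w) fun d => by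
        simp).comp_injective (sub_left_injective (b := p))).congr fun q => by
          show lam s * τ b s (q - p) * inner ℝ (hcpSite a h s) (u (p + s + (q - p))) = _
          rw [show p + s + (q - p) = q + s by abel]
    have hy : Summable fun q => lam s * τ b s (q - p) * inner ℝ (hcpSite a h s) (u q) :=
      ((hfin p (fun d w => lam s * τ b s d * inner ℝ (hcpSite a h s) w) fun d => by
        simp).comp_injective (sub_left_injective (b := p))).congr fun q => by simp
    exact (hx.sub hy).congr fun q => by rw [inner_sub_right]; ring
  have h3b : ∑' q, ∑ s ∈ Y, lam s * τ b s (q - p) * inner ℝ (hcpSite a h s) (u (q + s) - u q) =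
      ∑' d, ∑ s ∈ Y, lam s * τ b s d * inner ℝ (hcpSite a h s) (u (p + d + s) - u (p + d)) := by
    rw [← (Equiv.addLeft p).tsum_eq fun q => ∑ s ∈ Y, lam s * τ b s (q - p) *
      inner ℝ (hcpSite a h s) (u (q + s) - u q)]
    exact tsum_congr fun d => by simp
  rw [h1a.tsum_sub h1b, h2b.tsum_sub h3a, h1c, h1d, h2c, h3b, h1_divergence ha hh hV hF hτ hlam hY b hu p]
  ring

end Assembly

/-! ## The registered stub -/

/-- **H1 — first-order design at the hcp-family minimiser** (stub `stub_coreFirstOrderDesign`, reshape r3 of line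
`birth`).  EXPLICIT: stencil `Y = {(0,1,0), (0,0,1), (0,−1,1), (2,0,0)}`, `β(b, d, s) = λ_s · τ`, `τ` the tension
of the sender's directed stencil bond in the LINE TRUSS of the receiver (each frame component of the radial load
`W′(‖x‖²) x` carried along its own index line by the tail sum of the loads beyond it); lines are self-balanced by
half-integrality, tensions decay like `r⁻⁶`, and the vanishing of the total tension per bond class is exactly zero
site stress at the family minimiser (`core_zeroStress`). [folklore] -/
theorem stub_coreFirstOrderDesign : ∀ a h : ℝ, 0 < a → 0 < h → HcpFamilyMin a h → CoreFirstOrderDesign a h := by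
  intro a h ha hh hfam
  have hS := core_zeroStress ha hh hfam
  -- the design: bond vectors `V`, load lines `F`, line tensions `τ`, frame weights `λ` (opaque up to `rfl`)
  obtain ⟨V, hV⟩ : ∃ V : Bool → (ℤ × ℤ × ℤ) → EuclideanSpace ℝ (Fin 3), ∀ c d,
      V c d = if c = true then hcpSite a h d else -hcpSite a h (-d) := ⟨_, fun _ _ => rfl⟩
  obtain ⟨F, hF⟩ : ∃ F : Bool → (ℤ × ℤ × ℤ) → (ℤ × ℤ × ℤ) → ℤ → ℝ, ∀ c s d n, F c s d n =
      ljSqDeriv (‖V c (d + n • s)‖ ^ 2) * inner ℝ (V c (d + n • s)) (hcpSite a h s) := ⟨_, fun _ _ _ _ => rfl⟩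
  obtain ⟨τ, hτ⟩ : ∃ τ : Bool → (ℤ × ℤ × ℤ) → (ℤ × ℤ × ℤ) → ℝ, ∀ c s d,
      τ c s d = if 0 ≤ inner ℝ (V c d) (hcpSite a h s) then ∑' m : ℕ, F c s d ((m : ℤ) + 1)
        else -(F c s d 0 + ∑' m : ℕ, F c s d (-((m : ℤ) + 1))) := ⟨_, fun _ _ _ => rfl⟩
  obtain ⟨lam, hlam⟩ : ∃ lam : (ℤ × ℤ × ℤ) → ℝ, ∀ s,
      lam s = if s.1 = 0 then 2 / (3 * a ^ 2) else 1 / (4 * h ^ 2) := ⟨_, fun _ => rfl⟩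
  obtain ⟨K, hK0, hK⟩ : ∃ K : ℝ, 0 ≤ K ∧ K = 1 / 2 * (1 + (((min a h) ^ 2)⁻¹) ^ 3) *
      ((8 / 3 + (a + 2 * h) * (min a h)⁻¹) * (1 + (min a h)⁻¹) ^ 6 + 11 / 3 * ((min a h)⁻¹) ^ 6) :=
    ⟨_, by positivity, rfl⟩
  refine ⟨{(0, 1, 0), (0, 0, 1), (0, -1, 1), (2, 0, 0)}, fun b d s =>
    if s ∈ ({(0, 1, 0), (0, 0, 1), (0, -1, 1), (2, 0, 0)} : Finset (ℤ × ℤ × ℤ)) then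
      lam s * τ (if Even d.1 then b else !b) s (-d) else 0,
    (2 / (3 * a ^ 2) + 1 / (4 * h ^ 2)) * K, fun b d s hs => if_neg hs, fun p q s => ?_, fun u hu p => ?_⟩
  · -- decay
    beta_reduce
    by_cases hs : s ∈ ({(0, 1, 0), (0, 0, 1), (0, -1, 1), (2, 0, 0)} : Finset (ℤ × ℤ × ℤ))
    · rw [if_pos hs, abs_mul]
      have hpar : (if Even (q - p).1 then decide (Even p.1) else !decide (Even p.1)) = decide (Even q.1) := by
        show (if Even (q.1 - p.1) then _ else _) = _
        by_cases hp : Even p.1 <;> by_cases hq : Even q.1 <;> simp [hp, hq, Int.even_sub]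
      have hcov : V (decide (Even q.1)) (p - q) = hcpSite a h p - hcpSite a h q := by
        have := h1_sub_eq a h q (p - q)
        rw [add_sub_cancel] at this
        rw [this, hV]
        simp
      have hb := h1_tau_bound ha hh hV hF hτ (decide (Even q.1)) hs (p - q)
      rw [hcov, norm_sub_rev, ← hK] at hb
      rw [hpar, neg_sub, mul_assoc]
      refine mul_le_mul ?_ hb (abs_nonneg _) (by positivity)
      rw [hlam]
      split_ifs
      · rw [abs_of_pos (by positivity)]; linarith [(by positivity : (0 : ℝ) < 1 / (4 * h ^ 2))]
      · rw [abs_of_pos (by positivity)]; linarith [(by positivity : (0 : ℝ) < 2 / (3 * a ^ 2))]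
    · rw [if_neg hs, abs_zero]; positivity
  · -- the identity
    exact h1_identity ha hh hV hF hτ hS hlam rfl (β := fun b d s =>
      if s ∈ ({(0, 1, 0), (0, 0, 1), (0, -1, 1), (2, 0, 0)} : Finset (ℤ × ℤ × ℤ)) then
        lam s * τ (if Even d.1 then b else !b) s (-d) else 0) (fun b d s hs => if_pos hs) hu p

end Summit.AtomisticToContinuum.Crystallization.Theorems.StrictSplittingRuleBirth

end
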